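import Mathlib.LinearAlgebra.TensorProduct.Pi
import Literature.Algebra.Lie.ChevalleyEilenbergDirectSum
import Literature.NumberTheory.Automorphic.GKCohomology
import Literature.NumberTheory.Automorphic.GKModuleTensor
import HarnessLib

/-!
# `(𝔤, K)`-cohomology with a trivial finite-dimensional tensor factor

Topic `NumberTheory/Automorphic`; namespace `Literature.NumberTheory.Automorphic.GKTrivialTensor`.
Definitions with bodies and theorems only (no named fact, no `sorry`).

For `(𝔤, K)`-module data `(ρK, ρ𝔤)` on `V` (with the compatibility axiom `had`) and a complex
vector space `E` on which `K` and `𝔤` act TRIVIALLY (`trivK = 1`, `trivLie = 0`; e.g.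
`E = π_f^U`, the finite part at level `U`, on which `(𝔤_∞, K_∞)` does not act):

* `tensorEquivDirectSum b : V ⊗_ℂ E ≃ₗ[ℂ] ⨁_{i : ι} V` from a basis `b` of `E`
  (`v ⊗ e ↦ (b.repr e i • v)ᵢ`), upgraded to an isomorphism of `𝔤`-modules `carrierEquiv`
  (for the Leibniz action `ρ𝔤 X ⊗ 1`, `lie_triv_apply_tmul`) intertwining the diagonal
  `K`-action `ρK ⊗ 1` with the componentwise one `dsAction` (`carrierEquiv_τ`), `ℂ`-linear
  (`map_carrierEquiv_smul`);
* `cohomologyEquivPi b q : H^q(𝔤, K; V ⊗ E) ≃ₗ[ℝ] Πᵢ H^q(𝔤, K; V)` = isomorphism invariance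
  (`equiv₁`, `ChevalleyEilenbergDirectSum.IsoCoeff`) followed by additivity (`equiv₂`,
  `gKCohomologyDirectSumEquiv`) [cite: BorelWallach2000, I §1.2 (4)], and its `ℂ`-linear upgrade
  `cohomologyEquivPiℂ` (`equiv₁_smul`, `equiv₂_smul` via `ChevalleyEilenbergScalars`);
* `cohomologyEquivTensor q : H^q(𝔤, K; V ⊗ E) ≃ₗ[ℂ] H^q(𝔤, K; V) ⊗_ℂ E` for finite-dimensional
  `E` — **the Künneth rule for a trivial factor** [cite: BorelWallach2000, I §1.3 (2)] (the case
  `𝔤₂ = 𝔨₂ = 0`), the bookkeeping step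
  `H^•(𝔤, K; H_π^U ⊗ M) = H^•(𝔤, K; H_{π,∞} ⊗ M) ⊗ H_{π,f}^U` of the Eichler–Shimura–Harder /
  Matsushima decomposition (Harder 1987, p. 66; Borel–Wallach VII) behind the named facts
  `bianchi_interiorEigenclass_isCuspidal` and `GLnCohomology.*`.

* `cohomologyEquivPi_natural`, `cohomologyEquivTensor_natural` — **naturality** under a
  `ℂ`-linear endomorphism `T` of `V` commuting with `ρ𝔤`, `ρK`: the identifications carry
  `H(T ⊗ 1)` (`gkCohomologyMap` of `T.rTensor E`) to `H(T)` componentwise / to `H(T) ⊗ 1`, so they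
  are isomorphisms of modules over any algebra of operators commuting with `(𝔤, K)` (Hecke
  algebras); helpers `rTensor_comm_lie`, `rTensor_comm_K`, `tensorEquivDirectSum_rTensor_apply`,
  `piScalarRight_symm_natural`.

Here `H^q(𝔤, K; V ⊗ E)` is the tree's `GKTensor.cohomology G ρK ρ𝔤 trivK trivLie had _ q`, written
out as `gkCohomology G (ρK.tprod trivK) (GKTensor.lie G ρ𝔤 trivLie) (GKTensor.ad_compat …) q`.

Design note: all identities are proved componentwise on `⨁ᵢ V` at the level of `V` (`change` to
`ρ𝔤 X (… i)` / `ρK k (… i)`), because rewriting under the type synonym `GKCarrier` and the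
`DirectSum`/`DFinsupp` coercions is not robust; the pair actions share the common
`σ₀ = Ad ∘ (K ↪ G)` with named proofs (`hσ₀`, `σ₀_one`, `σ₀_mul`) so that `dsAction` and the
additivity isomorphism have syntactically equal types.

## References

* A. Borel, N. Wallach (2000), I §1.2 (4), §1.3 (2) (held) [BorelWallach2000].
* G. Harder, Invent. Math. 89 (1987), Ch. III p. 66 (the decomposition over `π`) [Harder1987].
-/

noncomputable section

namespace Literature.NumberTheory.Automorphic

open TensorProduct DirectSum Literature.Algebra.Lie

-- Mathlib idiom (as in `GKModules`): commutator bracket on `Module.End`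
attribute [local instance 100] LieRing.ofAssociativeRing

variable {A : Type*} [NormedCommRing A] [NormedAlgebra ℝ A] [NormedAlgebra ℚ A] [CompleteSpace A]
  [StarRing A] {N : Type*} [Fintype N] [DecidableEq N] (G : RealMatrixGroup A N)
  {V : Type*} [AddCommGroup V] [Module ℂ V]
  (ρK : Representation ℂ G.maximalCompact V) (ρ𝔤 : G.lie →ₗ⁅ℝ⁆ Module.End ℂ V)
  {E : Type*} [AddCommGroup E] [Module ℂ E]
  {ι : Type*} [Fintype ι] [DecidableEq ι]

namespace GKTrivialTensor

/-- The trivial `(𝔤, K)`-data on `E` satisfy the compatibility axiom. [folklore] -/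
theorem had_trivial (k : G.maximalCompact) (X : G.lie) :
    (1 : Representation ℂ G.maximalCompact E) k ∘ₗ (0 : G.lie →ₗ⁅ℝ⁆ Module.End ℂ E) X ∘ₗ
        (1 : Representation ℂ G.maximalCompact E) k⁻¹ =
      (0 : G.lie →ₗ⁅ℝ⁆ Module.End ℂ E)
        (G.Ad (Subgroup.inclusion G.maximalCompact_le_carrier k) X) := by
  simp

/-! #### The direct sum of copies of `V` -/

/-- Complex scalars commute with the (componentwise) `𝔤`-action on `⨁ᵢ V`. [folklore] -/
instance : ChevalleyEilenberg.LieSMulComm ℂ G.lie (⨁ _ : ι, GKCarrier G ρ𝔤) where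
  lie_smul_comm c X x := by
    ext i
    rw [DirectSum.lie_module_bracket_apply, DirectSum.smul_apply, DirectSum.smul_apply,
      DirectSum.lie_module_bracket_apply]
    exact ChevalleyEilenberg.LieSMulComm.lie_smul_comm c X (x i)

variable (had : ∀ (k : G.maximalCompact) (X : G.lie),
  ρK k ∘ₗ ρ𝔤 X ∘ₗ ρK k⁻¹ = ρ𝔤 (G.Ad (Subgroup.inclusion G.maximalCompact_le_carrier k) X))

/-- `Ad ∘ (K ↪ G)` as the common `σ`. [folklore] -/
abbrev σ₀ (k : G.maximalCompact) : G.lie →ₗ⁅ℝ⁆ G.lie :=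
  G.Ad (Subgroup.inclusion G.maximalCompact_le_carrier k)

/-- `σ₀ 1 = id`. [folklore] -/
theorem σ₀_one : σ₀ G 1 = LieHom.id := by
  rw [σ₀, map_one]; exact G.Ad_one

/-- `σ₀ (g h) = σ₀ g ∘ σ₀ h`. [folklore] -/
theorem σ₀_mul (g h : G.maximalCompact) : σ₀ G (g * h) = (σ₀ G g).comp (σ₀ G h) := by
  rw [σ₀, map_mul]; exact G.Ad_mul _ _

omit [Fintype ι] [DecidableEq ι] in
/-- The component pair actions have `σ = σ₀`. [folklore] -/
theorem hσ₀ (_i : ι) (g : G.maximalCompact) : (gkPairAction G ρK ρ𝔤 had).σ g = σ₀ G g := rfl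

variable (ι) in
/-- The componentwise pair action of `K` on `(𝔤, ⨁ᵢ V)`. [folklore] -/
def dsAction : ChevalleyEilenberg.PairAction ℝ G.lie (⨁ _ : ι, GKCarrier G ρ𝔤) G.maximalCompact :=
  ChevalleyEilenberg.PairAction.directSum (σ₀ G) (fun _ => gkPairAction G ρK ρ𝔤 had)
    (hσ₀ G ρK ρ𝔤 had) (σ₀_one G) (σ₀_mul G)

/-- The componentwise `K`-action is `ℂ`-linear. [folklore] -/
instance dsAction_smulComm : (dsAction G ρK ρ𝔤 ι had).SMulComm ℂ where
  τ_smul k c x := by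
    ext i
    simp only [dsAction, ChevalleyEilenberg.PairAction.directSum, DirectSum.lmap_apply,
      DirectSum.smul_apply]
    exact (ρK k).map_smul c (x i)

/-! #### The linear identification `V ⊗ E ≃ ⨁ᵢ V` given a basis of `E` -/

/-- `V ⊗_ℂ E ≃ ⨁_{i : ι} V` from a basis `b` of `E` indexed by `ι`:
`v ⊗ e ↦ (b.repr e i • v)ᵢ`. [folklore] -/
def tensorEquivDirectSum (b : Module.Basis ι ℂ E) : V ⊗[ℂ] E ≃ₗ[ℂ] ⨁ _ : ι, V :=
  TensorProduct.congr (LinearEquiv.refl ℂ V) b.equivFun ≪≫ₗ TensorProduct.piScalarRight ℂ ℂ V ι ≪≫ₗ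
    (DirectSum.linearEquivFunOnFintype ℂ ι (fun _ => V)).symm

/-- Components of `tensorEquivDirectSum` on pure tensors. [folklore] -/
@[simp]
theorem tensorEquivDirectSum_tmul_apply (b : Module.Basis ι ℂ E) (v : V) (e : E) (i : ι) :
    tensorEquivDirectSum b (v ⊗ₜ e) i = b.repr e i • v := by
  simp [tensorEquivDirectSum]
  rfl

/-! #### `V ⊗ E ≃ ⨁ᵢ V` as `𝔤`-modules and `K`-modules (trivial actions on `E`) -/

/-- The trivial `K`-action on `E`. [folklore] -/
abbrev trivK : Representation ℂ G.maximalCompact E := 1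
/-- The zero infinitesimal action on `E`. [folklore] -/
abbrev trivLie : G.lie →ₗ⁅ℝ⁆ Module.End ℂ E := 0

/-- The `𝔤`-action on `V ⊗ E` with `E` trivial is `ρ𝔤 X ⊗ 1`. [folklore] -/
theorem lie_triv_apply_tmul (X : G.lie) (v : V) (e : E) :
    GKTensor.lie G ρ𝔤 (trivLie G (E := E)) X (v ⊗ₜ e) = (ρ𝔤 X v) ⊗ₜ e := by
  rw [GKTensor.lie_apply_tmul]
  simp

/-- **`V ⊗ E ≃ ⨁ᵢ V` as `𝔤`-modules** (for the Leibniz action with `E` trivial), from a basis of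
`E`. [folklore] -/
def carrierEquiv (b : Module.Basis ι ℂ E) :
    GKCarrier G (GKTensor.lie G ρ𝔤 (trivLie G (E := E))) ≃ₗ⁅ℝ,G.lie⁆ (⨁ _ : ι, GKCarrier G ρ𝔤) :=
  { (tensorEquivDirectSum (V := V) b).restrictScalars ℝ with
    map_lie' := fun {X t} => by
      refine DirectSum.ext (β := fun _ : ι => GKCarrier G ρ𝔤) (fun i => ?_)
      change tensorEquivDirectSum b (GKTensor.lie G ρ𝔤 (trivLie G (E := E)) X t) i =
        ρ𝔤 X (tensorEquivDirectSum b t i)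
      induction t using TensorProduct.induction_on with
      | zero => simp only [map_zero, DirectSum.zero_apply]
      | add t₁ t₂ h₁ h₂ => simp only [map_add, DirectSum.add_apply, h₁, h₂]
      | tmul v e =>
        rw [lie_triv_apply_tmul, tensorEquivDirectSum_tmul_apply, tensorEquivDirectSum_tmul_apply,
          map_smul] }

/-- The identification intertwines the diagonal `K`-action `ρK ⊗ 1` with the componentwise one.
[folklore] -/
theorem carrierEquiv_τ (b : Module.Basis ι ℂ E) (k : G.maximalCompact)
    (t : GKCarrier G (GKTensor.lie G ρ𝔤 (trivLie G (E := E)))) :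
    carrierEquiv G ρ𝔤 b
        ((gkPairAction G (ρK.tprod (trivK G)) (GKTensor.lie G ρ𝔤 (trivLie G))
          (GKTensor.ad_compat G ρK ρ𝔤 (trivK G) (trivLie G) had (had_trivial G))).τ k t) =
      (dsAction G ρK ρ𝔤 ι had).τ k (carrierEquiv G ρ𝔤 b t) := by
  change tensorEquivDirectSum b (ρK.tprod (trivK G (E := E)) k t) =
    DirectSum.lmap (fun _ => (ρK k).restrictScalars ℝ) (tensorEquivDirectSum b t)
  induction t using TensorProduct.induction_on with
  | zero => simp
  | add t₁ t₂ h₁ h₂ =>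
    rw [map_add, map_add, h₁, h₂, map_add (tensorEquivDirectSum (V := V) b) t₁ t₂, map_add]
  | tmul v e =>
    refine DirectSum.ext (β := fun _ : ι => GKCarrier G ρ𝔤) (fun i => ?_)
    change tensorEquivDirectSum b (TensorProduct.map (ρK k) ((trivK G (E := E)) k) (v ⊗ₜ e)) i =
      ρK k (tensorEquivDirectSum b (v ⊗ₜ e) i)
    rw [TensorProduct.map_tmul, tensorEquivDirectSum_tmul_apply, tensorEquivDirectSum_tmul_apply,
      map_smul]
    rfl

/-- The identification is `ℂ`-linear on cochains. [folklore] -/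
theorem map_carrierEquiv_smul (b : Module.Basis ι ℂ E) (q : ℕ) (c : ℂ)
    (f : ChevalleyEilenberg.Cochain ℝ G.lie
      (GKCarrier G (GKTensor.lie G ρ𝔤 (trivLie G (E := E)))) q) :
    ChevalleyEilenberg.map G.lie
        (carrierEquiv G ρ𝔤 b : GKCarrier G (GKTensor.lie G ρ𝔤 (trivLie G (E := E))) →ₗ⁅ℝ,G.lie⁆
        (⨁ _ : ι, GKCarrier G ρ𝔤)) q (c • f) =
      c • ChevalleyEilenberg.map G.lie
        (carrierEquiv G ρ𝔤 b : GKCarrier G (GKTensor.lie G ρ𝔤 (trivLie G (E := E))) →ₗ⁅ℝ,G.lie⁆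
        (⨁ _ : ι, GKCarrier G ρ𝔤)) q f := by
  refine AlternatingMap.ext fun v => ?_
  exact (tensorEquivDirectSum (V := V) b).map_smul c (f v)

section Cohomology

variable [StarModule ℝ A]

/-- The identification is a cochain map of `(𝔤, K)`-complexes (forward).
[cite: BorelWallach2000, I §5.1] -/
theorem cochainMap₁ (b : Module.Basis ι ℂ E) :
    (ChevalleyEilenberg.Subcomplex.gK ℝ G.lie _ G.kInLie
        (gkPairAction G (ρK.tprod (trivK G (E := E))) (GKTensor.lie G ρ𝔤 (trivLie G))
          (GKTensor.ad_compat G ρK ρ𝔤 (trivK G) (trivLie G) had (had_trivial G)))).IsCochainMapTo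
      (ChevalleyEilenberg.Subcomplex.gK ℝ G.lie _ G.kInLie (dsAction G ρK ρ𝔤 ι had))
      (ChevalleyEilenberg.map G.lie
        (carrierEquiv G ρ𝔤 b : GKCarrier G (GKTensor.lie G ρ𝔤 (trivLie G (E := E))) →ₗ⁅ℝ,G.lie⁆
          (⨁ _ : ι, GKCarrier G ρ𝔤))) :=
  ChevalleyEilenberg.Subcomplex.isCochainMapTo_gK_map_of_comm G.kInLie
    (gkPairAction G (ρK.tprod (trivK G (E := E))) (GKTensor.lie G ρ𝔤 (trivLie G))
          (GKTensor.ad_compat G ρK ρ𝔤 (trivK G) (trivLie G) had (had_trivial G)))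
    (dsAction G ρK ρ𝔤 ι had) _ (fun _ => rfl) (carrierEquiv_τ G ρK ρ𝔤 had b)

/-- The identification is a cochain map of `(𝔤, K)`-complexes (backward).
[cite: BorelWallach2000, I §5.1] -/
theorem cochainMap₁_symm (b : Module.Basis ι ℂ E) :
    (ChevalleyEilenberg.Subcomplex.gK ℝ G.lie _ G.kInLie (dsAction G ρK ρ𝔤 ι had)).IsCochainMapTo
      (ChevalleyEilenberg.Subcomplex.gK ℝ G.lie _ G.kInLie
        (gkPairAction G (ρK.tprod (trivK G (E := E))) (GKTensor.lie G ρ𝔤 (trivLie G))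
          (GKTensor.ad_compat G ρK ρ𝔤 (trivK G) (trivLie G) had (had_trivial G))))
      (ChevalleyEilenberg.map G.lie
        ((carrierEquiv G ρ𝔤 b).symm : (⨁ _ : ι, GKCarrier G ρ𝔤) →ₗ⁅ℝ,G.lie⁆
          GKCarrier G (GKTensor.lie G ρ𝔤 (trivLie G (E := E))))) :=
  ChevalleyEilenberg.Subcomplex.isCochainMapTo_gK_map_of_comm G.kInLie (dsAction G ρK ρ𝔤 ι had)
    (gkPairAction G (ρK.tprod (trivK G (E := E))) (GKTensor.lie G ρ𝔤 (trivLie G))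
          (GKTensor.ad_compat G ρK ρ𝔤 (trivK G) (trivLie G) had (had_trivial G)))
    _ (fun _ => rfl) fun g m => by
      apply (carrierEquiv G ρ𝔤 b).injective
      change carrierEquiv G ρ𝔤 b ((carrierEquiv G ρ𝔤 b).symm ((dsAction G ρK ρ𝔤 ι had).τ g m)) =
        carrierEquiv G ρ𝔤 b
          ((gkPairAction G (ρK.tprod (trivK G (E := E))) (GKTensor.lie G ρ𝔤 (trivLie G))
            (GKTensor.ad_compat G ρK ρ𝔤 (trivK G) (trivLie G) had (had_trivial G))).τ g
            ((carrierEquiv G ρ𝔤 b).symm m))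
      rw [(carrierEquiv G ρ𝔤 b).apply_symm_apply, carrierEquiv_τ,
        (carrierEquiv G ρ𝔤 b).apply_symm_apply]

/-- Step 1 (isomorphism invariance): `H^q(𝔤, K; V ⊗ E) ≃ H^q(𝔤, 𝔨, K; ⨁ᵢ V)`.
[cite: BorelWallach2000, I §1.2] -/
def equiv₁ (b : Module.Basis ι ℂ E) (q : ℕ) :
    gkCohomology G (ρK.tprod (trivK G (E := E))) (GKTensor.lie G ρ𝔤 (trivLie G))
      (GKTensor.ad_compat G ρK ρ𝔤 (trivK G) (trivLie G) had (had_trivial G)) q ≃ₗ[ℝ]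
      ChevalleyEilenberg.gKCohomology ℝ G.lie (⨁ _ : ι, GKCarrier G ρ𝔤) G.kInLie
        (dsAction G ρK ρ𝔤 ι had) q :=
  (cochainMap₁ G ρK ρ𝔤 had b).cohomologyEquiv (cochainMap₁_symm G ρK ρ𝔤 had b)
    (fun q f _ => ChevalleyEilenberg.map_symm_map _ q f)
    (fun q f _ => ChevalleyEilenberg.map_map_symm _ q f) q

/-- `equiv₁` is the induced map of `carrierEquiv`. [folklore] -/
theorem equiv₁_apply (b : Module.Basis ι ℂ E) (q : ℕ) (x) :
    equiv₁ G ρK ρ𝔤 had b q x = (cochainMap₁ G ρK ρ𝔤 had b).cohomologyMap q x := rfl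

/-- Step 2 (additivity): `H^q(𝔤, 𝔨, K; ⨁ᵢ V) ≃ Πᵢ H^q(𝔤, K; V)`.
[cite: BorelWallach2000, I §1.2 (4)] -/
def equiv₂ (q : ℕ) :
    ChevalleyEilenberg.gKCohomology ℝ G.lie (⨁ _ : ι, GKCarrier G ρ𝔤) G.kInLie
        (dsAction G ρK ρ𝔤 ι had) q ≃ₗ[ℝ] (ι → gkCohomology G ρK ρ𝔤 had q) :=
  ChevalleyEilenberg.gKCohomologyDirectSumEquiv G.kInLie (σ₀ G)
    (fun _ => gkPairAction G ρK ρ𝔤 had) (hσ₀ G ρK ρ𝔤 had) (σ₀_one G) (σ₀_mul G) q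

/-- Components of `equiv₂` are the induced maps of the projections. [folklore] -/
theorem equiv₂_apply (q : ℕ) (x) (i : ι) :
    equiv₂ G ρK ρ𝔤 had q x i =
      (ChevalleyEilenberg.Subcomplex.isCochainMapTo_gK_proj G.kInLie (σ₀ G)
        (fun _ => gkPairAction G ρK ρ𝔤 had) (hσ₀ G ρK ρ𝔤 had) (σ₀_one G) (σ₀_mul G)
          i).cohomologyMap q x := rfl

/-- `equiv₁` is `ℂ`-linear. [folklore] -/
theorem equiv₁_smul (b : Module.Basis ι ℂ E) (q : ℕ) (c : ℂ) (x) :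
    equiv₁ G ρK ρ𝔤 had b q (c • x) = c • equiv₁ G ρK ρ𝔤 had b q x := by
  rw [equiv₁_apply, equiv₁_apply]
  exact (cochainMap₁ G ρK ρ𝔤 had b).cohomologyMap_smul _
    (fun q c f => map_carrierEquiv_smul G ρ𝔤 b q c f) q c x

/-- `equiv₂` is `ℂ`-linear. [folklore] -/
theorem equiv₂_smul (q : ℕ) (c : ℂ) (x) :
    equiv₂ G ρK ρ𝔤 had (ι := ι) q (c • x) = c • equiv₂ G ρK ρ𝔤 had (ι := ι) q x := by
  funext i
  rw [Pi.smul_apply, equiv₂_apply, equiv₂_apply]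
  exact ChevalleyEilenberg.Subcomplex.IsCochainMapTo.cohomologyMap_smul _ _
    (fun q c f => AlternatingMap.ext fun v => rfl) q c x

/-- **`H^q(𝔤, K; V ⊗ E) ≃ Πᵢ H^q(𝔤, K; V)`** (real-linear) for `E` with trivial actions and a basis
indexed by `ι`: isomorphism invariance along `V ⊗ E ≃ ⨁ᵢ V` followed by additivity.
[cite: BorelWallach2000, I §1.2 (4)] -/
def cohomologyEquivPi (b : Module.Basis ι ℂ E) (q : ℕ) :
    gkCohomology G (ρK.tprod (trivK G (E := E))) (GKTensor.lie G ρ𝔤 (trivLie G))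
      (GKTensor.ad_compat G ρK ρ𝔤 (trivK G) (trivLie G) had (had_trivial G)) q ≃ₗ[ℝ]
      (ι → gkCohomology G ρK ρ𝔤 had q) :=
  (equiv₁ G ρK ρ𝔤 had b q).trans (equiv₂ G ρK ρ𝔤 had q)

/-- The isomorphism is `ℂ`-linear. [folklore] -/
theorem cohomologyEquivPi_smul (b : Module.Basis ι ℂ E) (q : ℕ) (c : ℂ) (x) :
    cohomologyEquivPi G ρK ρ𝔤 had b q (c • x) = c • cohomologyEquivPi G ρK ρ𝔤 had b q x := by
  change equiv₂ G ρK ρ𝔤 had q (equiv₁ G ρK ρ𝔤 had b q (c • x)) =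
    c • equiv₂ G ρK ρ𝔤 had q (equiv₁ G ρK ρ𝔤 had b q x)
  rw [equiv₁_smul, equiv₂_smul]

/-- **`H^q(𝔤, K; V ⊗ E) ≃ₗ[ℂ] Πᵢ H^q(𝔤, K; V)`**. [cite: BorelWallach2000, I §1.2 (4)] -/
def cohomologyEquivPiℂ (b : Module.Basis ι ℂ E) (q : ℕ) :
    gkCohomology G (ρK.tprod (trivK G (E := E))) (GKTensor.lie G ρ𝔤 (trivLie G))
      (GKTensor.ad_compat G ρK ρ𝔤 (trivK G) (trivLie G) had (had_trivial G)) q ≃ₗ[ℂ]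
      (ι → gkCohomology G ρK ρ𝔤 had q) :=
  (cohomologyEquivPi G ρK ρ𝔤 had b q).toAddEquiv.toLinearEquiv
    (cohomologyEquivPi_smul G ρK ρ𝔤 had b q)

/-- **Künneth rule for a trivial finite-dimensional factor**:
`H^q(𝔤, K; V ⊗ E) ≃ₗ[ℂ] H^q(𝔤, K; V) ⊗_ℂ E` when `𝔤` and `K` act trivially on the
finite-dimensional `E` (e.g. `E = π_f^U`). [cite: BorelWallach2000, I §1.3 (2)] -/
def cohomologyEquivTensor [FiniteDimensional ℂ E] (q : ℕ) :
    gkCohomology G (ρK.tprod (trivK G (E := E))) (GKTensor.lie G ρ𝔤 (trivLie G))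
      (GKTensor.ad_compat G ρK ρ𝔤 (trivK G) (trivLie G) had (had_trivial G)) q ≃ₗ[ℂ]
      gkCohomology G ρK ρ𝔤 had q ⊗[ℂ] E :=
  (cohomologyEquivPiℂ G ρK ρ𝔤 had (Module.finBasis ℂ E) q).trans
    ((TensorProduct.piScalarRight ℂ ℂ _ _).symm.trans
      (TensorProduct.congr (LinearEquiv.refl ℂ _) (Module.finBasis ℂ E).equivFun.symm))

end Cohomology

/-! ### Naturality of the Künneth identification under equivariant endomorphisms -/

section Naturality

variable [StarModule ℝ A] (T : V →ₗ[ℂ] V) (hT𝔤 : ∀ X : G.lie, T ∘ₗ ρ𝔤 X = ρ𝔤 X ∘ₗ T)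
  (hTK : ∀ k : G.maximalCompact, T ∘ₗ ρK k = ρK k ∘ₗ T)

omit [Fintype ι] [DecidableEq ι] [StarModule ℝ A] in
include hT𝔤 in
/-- `T ⊗ 1` commutes with the Leibniz action `ρ𝔤 X ⊗ 1` on `V ⊗ E`. [folklore] -/
theorem rTensor_comm_lie (X : G.lie) :
    T.rTensor E ∘ₗ GKTensor.lie G ρ𝔤 (trivLie G (E := E)) X =
      GKTensor.lie G ρ𝔤 (trivLie G (E := E)) X ∘ₗ T.rTensor E := by
  rw [GKTensor.lie_apply, LieHom.zero_apply, LinearMap.lTensor_zero, add_zero,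
    ← LinearMap.rTensor_comp, hT𝔤 X, LinearMap.rTensor_comp]

omit [Fintype ι] [DecidableEq ι] [StarModule ℝ A] in
include hTK in
/-- `T ⊗ 1` commutes with the diagonal `K`-action `ρK ⊗ 1` on `V ⊗ E`. [folklore] -/
theorem rTensor_comm_K (k : G.maximalCompact) :
    T.rTensor E ∘ₗ ρK.tprod (trivK G (E := E)) k =
      ρK.tprod (trivK G (E := E)) k ∘ₗ T.rTensor E := by
  rw [Representation.tprod_apply]
  change T.rTensor E ∘ₗ TensorProduct.map (ρK k) LinearMap.id =
    TensorProduct.map (ρK k) LinearMap.id ∘ₗ T.rTensor E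
  simp only [LinearMap.rTensor, ← TensorProduct.map_comp, LinearMap.comp_id, hTK k]

omit [Fintype ι] in
/-- The identification `V ⊗ E ≃ ⨁ᵢ V` intertwines `T ⊗ 1` with `T` componentwise. [folklore] -/
theorem tensorEquivDirectSum_rTensor_apply (b : Module.Basis ι ℂ E) [Fintype ι] (t : V ⊗[ℂ] E)
    (i : ι) : tensorEquivDirectSum b (T.rTensor E t) i = T (tensorEquivDirectSum b t i) := by
  induction t using TensorProduct.induction_on with
  | zero => simp
  | add t₁ t₂ h₁ h₂ => simp only [map_add, DirectSum.add_apply, h₁, h₂]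
  | tmul v e =>
    rw [LinearMap.rTensor_tmul, tensorEquivDirectSum_tmul_apply, tensorEquivDirectSum_tmul_apply,
      map_smul]

/-- **Naturality of `H^q(𝔤, K; V ⊗ E) ≃ Πᵢ H^q(𝔤, K; V)`** under an equivariant endomorphism `T`
of `V`: the identification carries `H(T ⊗ 1)` to `H(T)` componentwise.
[cite: BorelWallach2000, I §1.2 (4)] -/
theorem cohomologyEquivPi_natural (b : Module.Basis ι ℂ E) (q : ℕ) (x) :
    cohomologyEquivPi G ρK ρ𝔤 had b q
        (gkCohomologyMap G (ρK.tprod (trivK G (E := E))) (GKTensor.lie G ρ𝔤 (trivLie G))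
          (GKTensor.ad_compat G ρK ρ𝔤 (trivK G) (trivLie G) had (had_trivial G)) (T.rTensor E)
          (rTensor_comm_lie G ρ𝔤 T hT𝔤) (rTensor_comm_K G ρK T hTK) q x) =
      fun i => gkCohomologyMap G ρK ρ𝔤 had T hT𝔤 hTK q (cohomologyEquivPi G ρK ρ𝔤 had b q x i) := by
  funext i
  change equiv₂ G ρK ρ𝔤 had q (equiv₁ G ρK ρ𝔤 had b q _) i =
    gkCohomologyMap G ρK ρ𝔤 had T hT𝔤 hTK q (equiv₂ G ρK ρ𝔤 had q (equiv₁ G ρK ρ𝔤 had b q x) i)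
  rw [equiv₂_apply, equiv₁_apply, gkCohomologyMap_apply, equiv₂_apply, equiv₁_apply,
    gkCohomologyMap_apply]
  exact ChevalleyEilenberg.Subcomplex.IsCochainMapTo.cohomologyMap_comp₃_congr
    (h₁ := ChevalleyEilenberg.Subcomplex.isCochainMapTo_gK_map G.kInLie _
      (GKCarrier.endo G _ (T.rTensor E) (rTensor_comm_lie G ρ𝔤 T hT𝔤))
      (GKCarrier.endo_comm G _ _ _ (T.rTensor E) (rTensor_comm_lie G ρ𝔤 T hT𝔤)
        (rTensor_comm_K G ρK T hTK)))
    (h₂ := cochainMap₁ G ρK ρ𝔤 had b)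
    (h₃ := ChevalleyEilenberg.Subcomplex.isCochainMapTo_gK_proj G.kInLie (σ₀ G)
      (fun _ => gkPairAction G ρK ρ𝔤 had) (hσ₀ G ρK ρ𝔤 had) (σ₀_one G) (σ₀_mul G) i)
    (h₁' := cochainMap₁ G ρK ρ𝔤 had b)
    (h₂' := ChevalleyEilenberg.Subcomplex.isCochainMapTo_gK_proj G.kInLie (σ₀ G)
      (fun _ => gkPairAction G ρK ρ𝔤 had) (hσ₀ G ρK ρ𝔤 had) (σ₀_one G) (σ₀_mul G) i)
    (h₃' := ChevalleyEilenberg.Subcomplex.isCochainMapTo_gK_map G.kInLie _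
      (GKCarrier.endo G ρ𝔤 T hT𝔤) (GKCarrier.endo_comm G ρK ρ𝔤 had T hT𝔤 hTK))
    (fun q f _ => AlternatingMap.ext fun v => tensorEquivDirectSum_rTensor_apply T b _ i) q x

omit [StarModule ℝ A] in
/-- Linear algebra: `(ι → H) ≃ H ⊗ (ι → ℂ)` (inverse of `piScalarRight`) is natural in `H`.
[folklore] -/
theorem piScalarRight_symm_natural {H : Type*} [AddCommGroup H] [Module ℂ H] (S : H →ₗ[ℂ] H)
    (g : ι → H) :
    (S.rTensor (ι → ℂ)) ((TensorProduct.piScalarRight ℂ ℂ H ι).symm g) =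
      (TensorProduct.piScalarRight ℂ ℂ H ι).symm (fun i => S (g i)) := by
  have key : (S.rTensor (ι → ℂ)) ∘ₗ (TensorProduct.piScalarRight ℂ ℂ H ι).symm.toLinearMap =
      (TensorProduct.piScalarRight ℂ ℂ H ι).symm.toLinearMap ∘ₗ S.compLeft ι := by
    refine LinearMap.pi_ext fun i h => ?_
    simp only [LinearMap.coe_comp, Function.comp_apply, LinearEquiv.coe_coe,
      TensorProduct.piScalarRight_symm_single, LinearMap.rTensor_tmul]
    change S h ⊗ₜ Pi.single i (1 : ℂ) =
      (TensorProduct.piScalarRight ℂ ℂ H ι).symm (fun j => S ((Pi.single i h : ι → H) j))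
    rw [show (fun j => S ((Pi.single i h : ι → H) j)) = Pi.single i (S h) from
      funext fun j => Pi.apply_single (fun (_ : ι) (y : H) => S y) (fun _ => map_zero S) i h j]
    exact (TensorProduct.piScalarRight_symm_single ℂ ℂ H ι (S h) i).symm
  exact LinearMap.congr_fun key g

/-- **Naturality of the Künneth rule** `H^q(𝔤, K; V ⊗ E) ≃ₗ[ℂ] H^q(𝔤, K; V) ⊗ E`: it carries
`H(T ⊗ 1)` to `H(T) ⊗ 1` — the identifications are isomorphisms of modules over any algebra of
operators commuting with `(𝔤, K)` (e.g. Hecke algebras). [cite: BorelWallach2000, I §1.3 (2)] -/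
theorem cohomologyEquivTensor_natural [FiniteDimensional ℂ E] (q : ℕ) (x) :
    cohomologyEquivTensor G ρK ρ𝔤 had (E := E) q
        (gkCohomologyMap G (ρK.tprod (trivK G (E := E))) (GKTensor.lie G ρ𝔤 (trivLie G))
          (GKTensor.ad_compat G ρK ρ𝔤 (trivK G) (trivLie G) had (had_trivial G)) (T.rTensor E)
          (rTensor_comm_lie G ρ𝔤 T hT𝔤) (rTensor_comm_K G ρK T hTK) q x) =
      (gkCohomologyMap G ρK ρ𝔤 had T hT𝔤 hTK q).rTensor E
        (cohomologyEquivTensor G ρK ρ𝔤 had (E := E) q x) := by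
  set b := Module.finBasis ℂ E
  set S := gkCohomologyMap G ρK ρ𝔤 had T hT𝔤 hTK q
  change TensorProduct.congr (LinearEquiv.refl ℂ _) b.equivFun.symm
      ((TensorProduct.piScalarRight ℂ ℂ _ _).symm (cohomologyEquivPi G ρK ρ𝔤 had b q _)) =
    (S.rTensor E) (TensorProduct.congr (LinearEquiv.refl ℂ _) b.equivFun.symm
      ((TensorProduct.piScalarRight ℂ ℂ _ _).symm (cohomologyEquivPi G ρK ρ𝔤 had b q x)))
  rw [cohomologyEquivPi_natural, ← piScalarRight_symm_natural]
  generalize (TensorProduct.piScalarRight ℂ ℂ _ _).symm (cohomologyEquivPi G ρK ρ𝔤 had b q x) = t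
  change (TensorProduct.map LinearMap.id b.equivFun.symm.toLinearMap)
      (TensorProduct.map S LinearMap.id t) =
    TensorProduct.map S LinearMap.id (TensorProduct.map LinearMap.id b.equivFun.symm.toLinearMap t)
  rw [← LinearMap.comp_apply, ← TensorProduct.map_comp,
    ← LinearMap.comp_apply (f := TensorProduct.map S _), ← TensorProduct.map_comp,
    LinearMap.id_comp, LinearMap.comp_id, LinearMap.id_comp, LinearMap.comp_id]

end Naturality

end GKTrivialTensor

end Literature.NumberTheory.Automorphic
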